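import Summits.Ventures.DiscreteObjects.PP12.OrderElevenTriangleLiftMeet

/-!
# PP(12), order-11 cell, Case B: valid `TriangleData 11` BUILD a projective plane of order 12 with a collineation of order 11 (kernel; the converse)
Framing: lottery ticket; floor = certified bounds/negative ranges.

Cell pub-namedobj (venture DiscreteObjects), target (M), designs gen 16. Part 2b of the converse of `OrderElevenTriangleValid`: with
`OrderElevenTriangleLiftMeet` (two distinct lines meet exactly once) and `|points| = |lines| = 157`, Mathlib's `HasPoints.hasLines` gives
**`triPlane11 : ProjectivePlane (VPt D) (VLn D)`**, of order 12 (`order_triPlane11`, the 13 points of a side), with the shift collineation `shift`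
(`x ↦ x + 1` on side points, free points, pencil and free lines; `shift¹¹ = 1`, `shift ≠ 1`; it fixes exactly the triangle); hence
`exists_plane_of_triangleData` (HIT route) and `noTriangleData12_of_noOrderEleven : NoOrderElevenOrder12 → NoTriangleData12`; with
`OrderElevenHomologyLift` and `OrderElevenReduction` this gives `NoCollineationOfOrderEleven ↔ NoOrderElevenOrder12` (`OrderElevenIff`) — the
typed census statement of the order-11 cell is EXACT. Nothing here asserts it. No `sorry`, no new axioms.
-/

namespace Summit.Ventures.DiscreteObjects.PP12

open Configuration Finset

namespace TriLift11

variable {D : TriangleData 11}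

/-! ### Finiteness and the plane -/

/-- points as a sum type -/
def VPt.equivSum : VPt D ≃ Fin 3 ⊕ (Fin 3 × Fin 11) ⊕ (Fin 11 × Fin 11) where
  toFun p := match p with | .vx k => Sum.inl k | .sp k x => Sum.inr (Sum.inl (k, x)) | .fr t x => Sum.inr (Sum.inr (t, x))
  invFun q := match q with | Sum.inl k => .vx k | Sum.inr (Sum.inl (k, x)) => .sp k x | Sum.inr (Sum.inr (t, x)) => .fr t x
  left_inv := by rintro (k | ⟨k, x⟩ | ⟨t, x⟩) <;> rfl
  right_inv := by rintro (k | ⟨k, x⟩ | ⟨t, x⟩) <;> rfl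

/-- lines as a sum type -/
def VLn.equivSum : VLn D ≃ Fin 3 ⊕ (Fin 3 × Fin 11) ⊕ (Fin 11 × Fin 11) where
  toFun m := match m with | .sd k => Sum.inl k | .pl k y => Sum.inr (Sum.inl (k, y)) | .fl s y => Sum.inr (Sum.inr (s, y))
  invFun q := match q with | Sum.inl k => .sd k | Sum.inr (Sum.inl (k, y)) => .pl k y | Sum.inr (Sum.inr (s, y)) => .fl s y
  left_inv := by rintro (k | ⟨k, y⟩ | ⟨s, y⟩) <;> rfl
  right_inv := by rintro (k | ⟨k, y⟩ | ⟨s, y⟩) <;> rfl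

/-- finitely many points -/
instance : Fintype (VPt D) := Fintype.ofEquiv _ VPt.equivSum.symm
/-- finitely many lines -/
instance : Fintype (VLn D) := Fintype.ofEquiv _ VLn.equivSum.symm

/-- as many points as lines -/
theorem card_VPt_eq_card_VLn : Fintype.card (VPt D) = Fintype.card (VLn D) := by
  rw [Fintype.card_congr (VPt.equivSum (D := D)), Fintype.card_congr (VLn.equivSum (D := D))]

/-- any two lines meet (and the structure is nondegenerate) -/
@[reducible] noncomputable def triHasPoints (hD : D.Valid) : HasPoints (VPt D) (VLn D) where
  exists_point := by
    rintro (k | ⟨k, y⟩ | ⟨s, y⟩)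
    · exact ⟨VPt.vx k, by simp⟩
    · exact ⟨VPt.fr 0 (y + poff D k 0 + 1), by simp⟩
    · exact ⟨VPt.vx 0, by simp⟩
  exists_line := by
    rintro (k | ⟨k, x⟩ | ⟨t, x⟩)
    · exact ⟨VLn.sd k, by simp⟩
    · exact ⟨VLn.pl k (x + 1), by simp⟩
    · exact ⟨VLn.sd 0, by simp⟩
  eq_or_eq := fun {p₁ p₂ l₁ l₂} h1 h2 h3 h4 => by
    by_cases hl : l₁ = l₂
    · exact Or.inr hl
    · exact Or.inl (meet_unique hD hl h1 h2 h3 h4)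
  mkPoint := fun {l₁ l₂} h => Classical.choose (exists_meet hD l₁ l₂ h)
  mkPoint_ax := fun {l₁ l₂} h => Classical.choose_spec (exists_meet hD l₁ l₂ h)

/-- **The plane built from valid triangle data.** -/
@[reducible] noncomputable def triPlane11 (hD : D.Valid) : ProjectivePlane (VPt D) (VLn D) :=
  let hP : HasPoints (VPt D) (VLn D) := triHasPoints hD
  let hL : HasLines (VPt D) (VLn D) := @HasPoints.hasLines _ _ _ hP _ _ card_VPt_eq_card_VLn
  { hP, hL with
    exists_config := ⟨VPt.vx 1, VPt.vx 0, VPt.fr 0 0, VLn.sd 0, VLn.pl 0 0, VLn.pl 0 1, by simp, by simp, by simp, by simp, by simp, by simp,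
      by simp, by simp⟩ }

/-- the side `S_0` carries exactly `v1, v2` and its 11 side points -/
theorem natCard_mem_sd0 : Nat.card {p : VPt D // p ∈ (VLn.sd 0 : VLn D)} = 13 := by
  let e : {p : VPt D // p ∈ (VLn.sd 0 : VLn D)} ≃ {k : Fin 3 // k ≠ 0} ⊕ Fin 11 :=
    { toFun := fun p => match p with
        | ⟨.vx k, h⟩ => Sum.inl ⟨k, h⟩
        | ⟨.sp _ x, _⟩ => Sum.inr x
        | ⟨.fr _ _, h⟩ => (h : False).elim
      invFun := fun q => match q with
        | Sum.inl ⟨k, h⟩ => ⟨.vx k, h⟩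
        | Sum.inr x => ⟨.sp 0 x, rfl⟩
      left_inv := by
        rintro ⟨k | ⟨k, x⟩ | ⟨t, x⟩, h⟩
        · rfl
        · have hk : k = 0 := h
          subst hk; rfl
        · exact (h : False).elim
      right_inv := by rintro (⟨k, h⟩ | x) <;> rfl }
  rw [Nat.card_congr e, Nat.card_eq_fintype_card, Fintype.card_sum, Fintype.card_fin, Fintype.card_subtype_compl, Fintype.card_fin]
  simp

/-- **The plane has order 12.** -/
theorem order_triPlane11 (hD : D.Valid) : @ProjectivePlane.order (VPt D) (VLn D) _ (triPlane11 hD) = 12 := by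
  letI := triPlane11 hD
  have h : Nat.card {p : VPt D // p ∈ (VLn.sd 0 : VLn D)} = ProjectivePlane.order (VPt D) (VLn D) + 1 :=
    ProjectivePlane.pointCount_eq (VPt D) (VLn.sd 0 : VLn D)
  rw [natCard_mem_sd0] at h
  omega

/-! ### The collineation of order 11 fixing the triangle -/

/-- shift on points -/
def shiftPt : VPt D → VPt D
  | .vx k => .vx k | .sp k x => .sp k (x + 1) | .fr t x => .fr t (x + 1)
/-- inverse shift on points -/
def unshiftPt : VPt D → VPt D
  | .vx k => .vx k | .sp k x => .sp k (x - 1) | .fr t x => .fr t (x - 1)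
/-- shift on lines -/
def shiftLn : VLn D → VLn D
  | .sd k => .sd k | .pl k y => .pl k (y + 1) | .fl s y => .fl s (y + 1)
/-- inverse shift on lines -/
def unshiftLn : VLn D → VLn D
  | .sd k => .sd k | .pl k y => .pl k (y - 1) | .fl s y => .fl s (y - 1)

/-- **the shift is a collineation** (it fixes exactly the triangle) -/
def shift : Collineation (VPt D) (VLn D) where
  onPoints := ⟨shiftPt, unshiftPt, by rintro (k | ⟨k, x⟩ | ⟨t, x⟩) <;> simp [shiftPt, unshiftPt],
    by rintro (k | ⟨k, x⟩ | ⟨t, x⟩) <;> simp [shiftPt, unshiftPt]⟩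
  onLines := ⟨shiftLn, unshiftLn, by rintro (k | ⟨k, y⟩ | ⟨s, y⟩) <;> simp [shiftLn, unshiftLn],
    by rintro (k | ⟨k, y⟩ | ⟨s, y⟩) <;> simp [shiftLn, unshiftLn]⟩
  mem_iff := by
    rintro (k | ⟨k, x⟩ | ⟨t, x⟩) (k' | ⟨k', y⟩ | ⟨s, y⟩) <;> simp [shiftPt, shiftLn, add_sub_add_right_eq_sub]
    all_goals rw [add_right_comm, add_left_inj]

/-- powers of the shift on free points -/
theorem shift_pow_fr (k : ℕ) (t x : Fin 11) :
    ((shift : Collineation (VPt D) (VLn D)).onPoints ^ k) (VPt.fr t x) = VPt.fr t (x + k • (1 : Fin 11)) := by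
  induction k with
  | zero => simp
  | succ k ih =>
    rw [pow_succ', Equiv.Perm.mul_apply, ih]
    show VPt.fr t (x + k • (1 : Fin 11) + 1) = _
    rw [succ_nsmul, add_assoc]

/-- powers of the shift on side points -/
theorem shift_pow_sp (k : ℕ) (c : Fin 3) (x : Fin 11) :
    ((shift : Collineation (VPt D) (VLn D)).onPoints ^ k) (VPt.sp c x) = VPt.sp c (x + k • (1 : Fin 11)) := by
  induction k with
  | zero => simp
  | succ k ih =>
    rw [pow_succ', Equiv.Perm.mul_apply, ih]
    show VPt.sp c (x + k • (1 : Fin 11) + 1) = _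
    rw [succ_nsmul, add_assoc]

/-- `shift¹¹ = 1` -/
theorem shift_pow_eleven : (shift : Collineation (VPt D) (VLn D)).onPoints ^ 11 = 1 := by
  ext p
  rcases p with k | ⟨c, x⟩ | ⟨t, x⟩
  · rw [Equiv.Perm.pow_apply_eq_self_of_apply_eq_self (rfl : shift.onPoints (VPt.vx k : VPt D) = _)]; rfl
  · rw [shift_pow_sp, show (11 • (1 : Fin 11)) = 0 from by decide, add_zero]; rfl
  · rw [shift_pow_fr, show (11 • (1 : Fin 11)) = 0 from by decide, add_zero]; rfl

/-- `shift ≠ 1` -/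
theorem shift_ne_one : (shift : Collineation (VPt D) (VLn D)).onPoints ≠ 1 := by
  intro h
  have h' := congrArg (fun τ : Equiv.Perm (VPt D) => τ (VPt.sp 0 0)) h
  have h'' : (VPt.sp 0 (0 + 1) : VPt D) = VPt.sp 0 0 := h'
  simp at h''

end TriLift11

open TriLift11 in
/-- **HIT route / exactness:** valid triangle data give a projective plane of order 12 with a collineation `σ ≠ 1`, `σ¹¹ = 1`. -/
theorem exists_plane_of_triangleData (D : TriangleData 11) (hD : D.Valid) :
    ∃ (P L : Type) (_ : Membership P L) (_ : Fintype P) (_ : Fintype L) (_ : ProjectivePlane P L),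
      ProjectivePlane.order P L = 12 ∧ ∃ σ : Collineation P L, σ.onPoints ^ 11 = 1 ∧ σ.onPoints ≠ 1 :=
  ⟨VPt D, VLn D, inferInstance, inferInstance, inferInstance, triPlane11 hD, order_triPlane11 hD, shift, shift_pow_eleven, shift_ne_one⟩

/-- **The converse reduction, Case B: `NoOrderElevenOrder12 → NoTriangleData12`.** -/
theorem noTriangleData12_of_noOrderEleven (h : NoOrderElevenOrder12) : NoTriangleData12 := by
  intro D hD
  obtain ⟨P, L, i1, i2, i3, i4, h12, σ, hq, hne⟩ := exists_plane_of_triangleData D hD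
  exact hne (h P L h12 σ hq)

end Summit.Ventures.DiscreteObjects.PP12
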